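import Mathlib
import Summits.NavierStokesRegularity.NavierStokesRegularity.Theorems.EulerZoomLiouvillePowerGaugeEulerLiouvilleSelfSimilarPressureStrainExcess
import Summits.NavierStokesRegularity.NavierStokesRegularity.Theorems.EulerZoomLiouvillePowerGaugeEulerLiouvilleSelfSimilarPressureParking
import Literature.Analysis.FluidPDE.TaoEnstrophyLocalisation
import HarnessLib

/-!
# Pressure excess is bounded by the local SUPREMUM of the strain excess (quantitative `Q`-criterion form of T2) for the crux
# `EulerZoomLiouville.PowerGaugeEulerLiouville` (stmt-NavierStokesRegularity-19832; LEAD ns-typeII-p2 g12 RESIDUE-MEMO §2 T2; width seat ns-ezl-w1 g4)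

Route №10 `EulerZoomLiouville` (NavierStokesRegularity).  Quantitative companion of `…SelfSimilarPressureStrainExcess`: the kernel of the exact
defect identity has mass `∫ Q ≤ sup Q · |B_{2R}| = 16 v₁ R²/m` (`v₁ = |B₁|`, `m = baseBumpMass ℝ³`), so

* `pressure_defect_le_of_strainExcess_le` — if the strain excess `|∇V|²_F − |curl V|²` is `≤ B` (`B ≥ 0`) on `B_{2R}(x₀)`, then
  `P′(x₀) − ∫ χ_R P′(x₀+·) ≤ 8 v₁ R² B / m`.

With `R = R_L ≍ L^{−(1+2ρ)/3}` (the `D`-gauge's averaging radius) the right side is `≲ B · L^{−2(1+2ρ)/3}` against a pressure excess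
`κ L²`: a far field whose strain excess grows slower than `‖z‖^{2 + 2(1+2ρ)/3}` cannot be pressurised (member form and stratum:
`…SelfSimilarStrainExcessGrowth`).  HONEST LABEL: portrait tool.  WHAT THIS IS NOT: not NS, not E — `--supports` stmt-19832; 19832 OPEN.
[cite: GilbargTrudinger2001, Thm. 2.1]
-/

noncomputable section

-- flat `Theorems/<Route><Decl>…` files of one crux share the namespace of the crux (tree convention)
set_option linter.dupNamespace false

open MeasureTheory Set Filter Topology Metric Function InnerProductSpace TopologicalSpace
open scoped RealInnerProductSpace NNReal ENNReal

namespace Summit.NavierStokesRegularity.NavierStokesRegularity.Theorems.PowerGaugeEulerLiouville.PressureParking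

open Literature.Analysis Literature.Analysis.FluidPDE

/-- **Kernel integrals against a locally bounded function**: for a continuous kernel `0 ≤ Q ≤ M` vanishing for `‖y‖ ≥ 2R` and a
continuous `g` with `g(x₀ + s y) ≤ B` (`B ≥ 0`) whenever `‖y‖ < 2R`, `∫ Q(y) g(x₀ + s y) dy ≤ M B |B_{2R}|`. [folklore] -/
theorem integral_kernel_mul_le {Q g : EuclideanSpace ℝ (Fin 3) → ℝ} (hQc : Continuous Q) (hQ0 : ∀ y, 0 ≤ Q y) {M R : ℝ}
    (hQM : ∀ y, Q y ≤ M) (hR : 0 < R) (hQsupp : ∀ y, 2 * R ≤ ‖y‖ → Q y = 0) (hg : Continuous g)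
    (x₀ : EuclideanSpace ℝ (Fin 3)) (s : ℝ) {B : ℝ} (hB0 : 0 ≤ B)
    (hgB : ∀ y : EuclideanSpace ℝ (Fin 3), ‖y‖ < 2 * R → g (x₀ + s • y) ≤ B) :
    ∫ y, Q y * g (x₀ + s • y) ≤
      M * B * ((2 * R) ^ 3 * (volume (ball (0 : EuclideanSpace ℝ (Fin 3)) 1)).toReal) := by
  have hQcs : HasCompactSupport Q := hasCompactSupport_of_eq_zero_of_le_norm hQsupp
  have hint : Integrable (fun y => Q y * g (x₀ + s • y)) := by
    refine Continuous.integrable_of_hasCompactSupport (hQc.mul (hg.comp ?_)) (hQcs.mul_right)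
    exact continuous_const.add (continuous_const_smul s)
  set h : EuclideanSpace ℝ (Fin 3) → ℝ :=
    (ball (0 : EuclideanSpace ℝ (Fin 3)) (2 * R)).indicator fun _ => M * B with hh
  have hhint : Integrable h := by
    rw [hh]
    exact (integrable_indicator_iff measurableSet_ball).2 (integrableOn_const (hs := measure_ball_lt_top.ne))
  have hle : ∀ y, Q y * g (x₀ + s • y) ≤ h y := by
    intro y
    by_cases hy : y ∈ ball (0 : EuclideanSpace ℝ (Fin 3)) (2 * R)
    · rw [hh, indicator_of_mem hy]
      rw [mem_ball_zero_iff] at hy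
      calc Q y * g (x₀ + s • y) ≤ Q y * B := mul_le_mul_of_nonneg_left (hgB y hy) (hQ0 y)
        _ ≤ M * B := mul_le_mul_of_nonneg_right (hQM y) hB0
    · rw [hh, indicator_of_notMem hy]
      rw [mem_ball_zero_iff, not_lt] at hy
      rw [hQsupp y hy, zero_mul]
  calc ∫ y, Q y * g (x₀ + s • y) ≤ ∫ y, h y := integral_mono hint hhint hle
    _ = M * B * ((2 * R) ^ 3 * (volume (ball (0 : EuclideanSpace ℝ (Fin 3)) 1)).toReal) := by
        rw [hh, integral_indicator measurableSet_ball, setIntegral_const, smul_eq_mul, measureReal_def,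
          volume_ball_toReal (by positivity : (0 : ℝ) < 2 * R), mul_comm]

/-- **PRESSURE DEFECT ≤ LOCAL SUP OF THE STRAIN EXCESS.**  For a `C²` self-similar Euler profile and `R > 0`: if
`|∇V(z)|²_F − |curl V(z)|² ≤ B` (`B ≥ 0`) for all `z ∈ B_{2R}(x₀)`, then
`P′(x₀) − ∫ χ_R(y) P′(x₀ + y) dy ≤ 8 v₁ R² B / m` (`v₁ = |B₁|`, `m = baseBumpMass ℝ³`). [cite: GilbargTrudinger2001, Thm. 2.1] -/
theorem pressure_defect_le_of_strainExcess_le {γ : ℝ} {c : EuclideanSpace ℝ (Fin 3)}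
    {V : EuclideanSpace ℝ (Fin 3) → EuclideanSpace ℝ (Fin 3)} {P' : EuclideanSpace ℝ (Fin 3) → ℝ}
    (hprof : IsSelfSimilarEulerProfile γ c V P') {R : ℝ} (hR : 0 < R) (x₀ : EuclideanSpace ℝ (Fin 3)) {B : ℝ}
    (hB0 : 0 ≤ B) (hgB : ∀ z ∈ ball x₀ (2 * R), frobeniusNormSq (fderiv ℝ V z) - ‖curl V z‖ ^ 2 ≤ B) :
    P' x₀ - (∫ y, probeBump R y * P' (x₀ + y)) ≤
      8 * (volume (ball (0 : EuclideanSpace ℝ (Fin 3)) 1)).toReal * R ^ 2 * B /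
        baseBumpMass (EuclideanSpace ℝ (Fin 3)) := by
  have hm : 0 < baseBumpMass (EuclideanSpace ℝ (Fin 3)) := baseBumpMass_pos
  set v₁ : ℝ := (volume (ball (0 : EuclideanSpace ℝ (Fin 3)) 1)).toReal with hv₁
  have hv : 0 ≤ v₁ := ENNReal.toReal_nonneg
  obtain ⟨Q, hQc, hQ0, hQsupp, hQle, hid⟩ := pressure_defect_eq_strainExcess hprof hR
  set g : EuclideanSpace ℝ (Fin 3) → ℝ := fun z => frobeniusNormSq (fderiv ℝ V z) - ‖curl V z‖ ^ 2 with hgdef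
  have hV2 : ContDiff ℝ 2 V := hprof.contDiff_velocity
  have hgc : Continuous g := by
    have h1 : Continuous fun z => fderiv ℝ V z := hV2.continuous_fderiv (by simp)
    have hF : Continuous fun L : EuclideanSpace ℝ (Fin 3) →L[ℝ] EuclideanSpace ℝ (Fin 3) => frobeniusNormSq L := by
      unfold frobeniusNormSq
      exact continuous_finsetSum _ fun i _ => ((ContinuousLinearMap.apply ℝ (EuclideanSpace ℝ (Fin 3)) _).continuous.norm).pow 2
    have h2 : Continuous fun z => frobeniusNormSq (fderiv ℝ V z) := hF.comp h1
    have h3 : Continuous (curl V) := by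
      rw [curl_eq_curlCLM_comp]
      exact curlCLM.continuous.comp h1
    exact h2.sub (h3.norm.pow 2)
  set M : ℝ := 2 * R ^ 2 * (baseBumpMass (EuclideanSpace ℝ (Fin 3)) *
    R ^ Module.finrank ℝ (EuclideanSpace ℝ (Fin 3)))⁻¹ with hMdef
  have hM : M = 2 / (baseBumpMass (EuclideanSpace ℝ (Fin 3)) * R) := by
    rw [hMdef, finrank_euclideanSpace_fin]
    field_simp
  -- inner integrals
  have hinner : ∀ s ∈ Icc (0 : ℝ) 1, ∫ y, Q y * g (x₀ + s • y) ≤ M * B * ((2 * R) ^ 3 * v₁) := by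
    intro s hs
    refine integral_kernel_mul_le hQc hQ0 hQle hR hQsupp hgc x₀ s hB0 fun y hy => hgB _ ?_
    rw [mem_ball, dist_eq_norm, add_sub_cancel_left, norm_smul, Real.norm_of_nonneg hs.1]
    nlinarith [hs.2, norm_nonneg y]
  -- the `s`-integral
  have hQcs : HasCompactSupport Q := hasCompactSupport_of_eq_zero_of_le_norm hQsupp
  have hFc : Continuous fun s : ℝ => ∫ y, Q y * g (x₀ + s • y) := continuous_integral_mul_comp_add_smul hQc hQcs hgc x₀
  have hout : ∫ s in (0 : ℝ)..1, s * ∫ y, Q y * g (x₀ + s • y) ≤ ∫ s in (0 : ℝ)..1, s * (M * B * ((2 * R) ^ 3 * v₁)) := by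
    refine intervalIntegral.integral_mono_on zero_le_one ((continuous_id.mul hFc).intervalIntegrable _ _)
      ((continuous_id.mul continuous_const).intervalIntegrable _ _) fun s hs => ?_
    exact mul_le_mul_of_nonneg_left (hinner s hs) hs.1
  have hconst : ∫ s in (0 : ℝ)..1, s * (M * B * ((2 * R) ^ 3 * v₁)) = M * B * ((2 * R) ^ 3 * v₁) / 2 := by
    rw [intervalIntegral.integral_mul_const, integral_id]
    ring
  have hfinal : M * B * ((2 * R) ^ 3 * v₁) / 2 = 8 * v₁ * R ^ 2 * B / baseBumpMass (EuclideanSpace ℝ (Fin 3)) := by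
    rw [hM]
    field_simp
    ring
  have := hid x₀
  rw [this]
  calc ∫ s in (0 : ℝ)..1, s * ∫ y, Q y * g (x₀ + s • y)
      ≤ ∫ s in (0 : ℝ)..1, s * (M * B * ((2 * R) ^ 3 * v₁)) := hout
    _ = 8 * v₁ * R ^ 2 * B / baseBumpMass (EuclideanSpace ℝ (Fin 3)) := by rw [hconst, hfinal]

end Summit.NavierStokesRegularity.NavierStokesRegularity.Theorems.PowerGaugeEulerLiouville.PressureParking

end
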